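import Literature.AlgebraicGeometry.Resolution.HuGoverningRelations
import Literature.AlgebraicGeometry.Resolution.BlowupAlgebraProduct
import HarnessLib

/-!
# The standard charts of Hu's singular model `𝒱 ⊆ 𝕌 × ∏_F ℙ_F` (Hu 2025, §4.1, Cor. 4.46, Def. 4.52)

Topic: `Literature/AlgebraicGeometry/Resolution`. Y. Hu, *Universal characteristic-free
resolution of singularities, I* (arXiv:2507.21400), §4.1: `𝒱 ⊆ 𝓡 = 𝕌 × ∏_{F ∈ 𝓕} ℙ_F` is the
closure of the graph of the rational map `Θ : 𝕌_Gr ⇢ ∏_F ℙ_F`,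
`[x_u] ↦ ([x_{u_s} x_{v_s}]_{s ∈ S_F})_F` ((4.1)–(4.3)); it is integral, `𝒱 → 𝕌_Gr` is projective
birational, and (Cor. 4.46) `𝒱` is cut out in `𝓡` by `𝓑^℘ ⊇ 𝓑^gov ∪ 𝓑^ngv`, `𝓑^𝔯𝔟` and the
linearized Plücker relations `L_𝓕`. A standard chart `𝔙` of `𝓡` is the choice, for every `F`, of
one homogeneous coordinate `x_{(u_{o_F}, v_{o_F})}` of `ℙ_F` set to `1` (Def. 4.52 ff., Def. 5.1:
"`x_{𝔙,(u_s,v_s)} = x_{(u_s,v_s)} / x_{(u_{o_F},v_{o_F})}`, `x_{𝔙,(u_{o_F},v_{o_F})} ≡ 1`").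

In the `[I₃ | A]`-anchored coordinates of the tree (`HuVar`, `HuRVar`, `plEval : x_u ↦ minor_u`,
`huPhi = φ`) this file realizes **the chart `𝒱 ∩ 𝔙` as a ring**, for every chart choice
`o : 𝓕 → {𝔯-variables}`, `o_F ∈ Λ_F`:

* `rCoordVal λ ∈ R[a_ij]` — the value `t_λ` of the homogeneous coordinate `λ` of `ℙ_F` on the
  graph: `x_{(𝔪,u_F)} ↦ minor_{u_F}`, `x_{(u_s,v_s)} ↦ minor_{u_s} · minor_{v_s}`
  (`= plEval (φ (x_λ))`, `plEval_huPhi_X_rvar`); `termIdeal F = (t_λ : λ ∈ Λ_F)` — the ideal `J_F`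
  whose blow-up resolves the `F`-th factor of `Θ`;
* `chartEval o : R[x_u, x_λ] →ₐ[R] R[a_ij][1/∏_F t_{o_F}]` — **restriction to the graph on the
  chart `𝔙_o`**: `x_u ↦ minor_u`, `x_λ ↦ t_λ / t_{o_{F(λ)}}`; PROVED: `chartEval_X_choice`
  (`x_{o_F} ↦ 1`, the de-homogenisation), `chartEval_govBinomial`, `chartEval_ngvBinomial` (same `F`),
  `chartEval_linPl` (**the governing binomials, the non-governing binomials and the linearized
  Plücker relations vanish on `𝒱 ∩ 𝔙`** — the containment half of Cor. 4.46, which is all that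
  §8 uses), `chartEval_rename_inl` (on `R₀` it is `x_u ↦ minor_u`);
* `range_chartEval` — **the coordinate ring of `𝒱 ∩ 𝔙_o`, i.e. the image of `chartEval o`, is the
  affine blowup algebra `R[a_ij][(∏_F J_F)/(∏_F t_{o_F})]`**: so `𝒱 = Bl_{∏_F J_F} 𝕌_Gr`
  glued from these charts (by `BlowupAlgebraProduct`, `AffineBlowup*`), which is how the tree
  obtains "`𝒱` integral, `𝒱 → 𝕌_Gr` projective birational" (Hu, Prop. 4.x/Cor. 4.46) without the
  toric-ideal analysis of §4.2–4.4.

Everything is proved; no named facts (D-0026).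

## References

* Y. Hu, *Universal Characteristic-free Resolution of Singularities, I*, arXiv:2507.21400 (2025),
  §4.1 (4.1)–(4.4), Def. 4.2, Cor. 4.46, Def. 4.49, Def. 4.52, §5 Def. 5.1 (theorem numbers of
  the arXiv v1 TeX source). [Hu2025]
* The Stacks Project, Tags 052P, 080A, 01OF (affine blowup algebras; blowing up a product;
  closure of a graph). [StacksProject]
-/

noncomputable section

open MvPolynomial IsLocalization

namespace Literature.AlgebraicGeometry.Resolution

universe u

namespace HuRVar

variable {m : ℕ}

/-- The relation `F` whose projective space `ℙ_F` carries the `𝔯`-variable. [cite: Hu2025, §4.1 Def. 4.1] -/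
def relOf : HuRVar m → LeadVar m
  | Sum.inl F => F
  | Sum.inr s => s.rel

/-- `relOf` of a leading `𝔯`-variable. [folklore] -/
@[simp] theorem relOf_inl (F : LeadVar m) : relOf (Sum.inl F : HuRVar m) = F := rfl

/-- `relOf` of a term `𝔯`-variable. [folklore] -/
@[simp] theorem relOf_inr (s : HuTerm m) : relOf (Sum.inr s : HuRVar m) = s.rel := rfl

end HuRVar

section Charts

variable (R : Type u) [CommRing R] (m : ℕ)

/-- **The value `t_λ ∈ R[a_ij]` of the homogeneous coordinate `x_λ` of `ℙ_F` on the graph of `Θ_F`**: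
`x_{(𝔪,u_F)} ↦ x_𝔪 x_{u_F} = minor_{u_F}`, `x_{(u_s,v_s)} ↦ x_{u_s} x_{v_s} = minor_{u_s} minor_{v_s}`.
[cite: Hu2025, §4.1 (4.1)–(4.2)] -/
def rCoordVal : HuRVar m → MvPolynomial (Fin 3 × Fin m) R
  | Sum.inl F => HuGamma.minor R m (HuVar.toTriple (Sum.inr F))
  | Sum.inr s => HuGamma.minor R m (HuVar.toTriple s.fst) * HuGamma.minor R m (HuVar.toTriple s.snd)

/-- `t_{(𝔪,u_F)} = minor_{u_F}`. [cite: Hu2025, §4.1 (4.1)] -/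
@[simp] theorem rCoordVal_inl (F : LeadVar m) :
    rCoordVal R m (Sum.inl F) = HuGamma.minor R m (HuVar.toTriple (Sum.inr F)) := rfl

/-- `t_{(u_s,v_s)} = minor_{u_s} minor_{v_s}`. [cite: Hu2025, §4.1 (4.1)] -/
@[simp] theorem rCoordVal_inr (s : HuTerm m) :
    rCoordVal R m (Sum.inr s) =
      HuGamma.minor R m (HuVar.toTriple s.fst) * HuGamma.minor R m (HuVar.toTriple s.snd) := rfl

/-- `t_λ = plEval (φ (x_λ))`: the value is the monomial `φ(x_λ)` read in the model. [cite: Hu2025, §4.1 (4.4)] -/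
@[simp] theorem plEval_huPhi_X_rvar (l : HuRVar m) :
    plEval R m (huPhi R m (X (Sum.inr l))) = rCoordVal R m l := by
  rcases l with F | s
  · change plEval R m (huPhi R m (X (HuRVar.rlead F))) = _
    rw [huPhi_X_rlead, plEval_X, rCoordVal_inl]
  · change plEval R m (huPhi R m (X (HuRVar.rterm s))) = _
    rw [huPhi_X_rterm, map_mul, plEval_X, plEval_X, rCoordVal_inr]

/-- `φ` fixes constants. [folklore] -/
theorem huPhi_C (c : R) : huPhi R m (C c) = C c := (huPhi R m).commutes c

/-- `plEval` fixes constants. [folklore] -/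
theorem plEval_C (c : R) : plEval R m (C c) = C c := (plEval R m).commutes c

/-- **The ideal `J_F = (t_λ : λ ∈ Λ_F) = (x_{u_s} x_{v_s} : s ∈ S_F)` of `R[a_ij]`** — base locus
of the `F`-th factor `Θ_F` of `Θ`. [cite: Hu2025, §4.1 (4.1)] -/
def termIdeal (F : LeadVar m) : Ideal (MvPolynomial (Fin 3 × Fin m) R) :=
  Ideal.span (rCoordVal R m '' {l | l.relOf = F})

/-- `t_λ ∈ J_{F(λ)}`. [folklore] -/
theorem rCoordVal_mem_termIdeal (l : HuRVar m) : rCoordVal R m l ∈ termIdeal R m l.relOf :=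
  Ideal.subset_span ⟨l, rfl, rfl⟩

variable (o : LeadVar m → HuRVar m)

/-- **The denominator `∏_F t_{o_F}` of the chart `𝔙_o`** (`o_F ∈ Λ_F` the coordinate of `ℙ_F` set
to `1`). [cite: Hu2025, Def. 4.52 and §5 Def. 5.1] -/
abbrev chartDenom : MvPolynomial (Fin 3 × Fin m) R := ∏ F, rCoordVal R m (o F)

/-- **Restriction to the graph on the chart `𝔙_o`**: `x_u ↦ minor_u`,
`x_λ ↦ x_{𝔙,λ} = t_λ / t_{o_{F(λ)}}` (written over the common denominator `∏_F t_{o_F}`).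
[cite: Hu2025, §4.1 (4.3) and §5 Def. 5.1] -/
def chartEval : HuRing R m →ₐ[R] Localization.Away (chartDenom R m o) :=
  aeval (Sum.elim
    (fun v => algebraMap (MvPolynomial (Fin 3 × Fin m) R) _ (HuGamma.minor R m (HuVar.toTriple v)))
    (fun l => prodChartGen Finset.univ (fun F => rCoordVal R m (o F)) l.relOf (rCoordVal R m l)))

/-- `chartEval` on a `𝔭`-variable: `x_u ↦ minor_u`. [cite: Hu2025, §4.1 (4.3)] -/
@[simp] theorem chartEval_X_inl (v : HuVar m) :
    chartEval R m o (X (Sum.inl v)) =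
      algebraMap (MvPolynomial (Fin 3 × Fin m) R) _ (HuGamma.minor R m (HuVar.toTriple v)) := by
  simp [chartEval]

/-- `chartEval` on an `𝔯`-variable: `x_λ ↦ t_λ / t_{o_{F(λ)}}`. [cite: Hu2025, §5 Def. 5.1] -/
@[simp] theorem chartEval_X_inr (l : HuRVar m) :
    chartEval R m o (X (Sum.inr l)) =
      prodChartGen Finset.univ (fun F => rCoordVal R m (o F)) l.relOf (rCoordVal R m l) := by
  simp [chartEval]

/-- `chartEval` on constants. [folklore] -/
theorem chartEval_C (c : R) :
    chartEval R m o (C c) = algebraMap (MvPolynomial (Fin 3 × Fin m) R) _ (C c) := by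
  rw [show (C c : HuRing R m) = algebraMap R (HuRing R m) c from rfl, AlgHom.commutes,
    IsScalarTower.algebraMap_apply R (MvPolynomial (Fin 3 × Fin m) R) (Localization.Away (chartDenom R m o))]
  rfl

/-- **On `R₀ = R[x_u]` the chart map is `x_u ↦ minor_u`** followed by `R[a_ij] → R[a_ij][1/g]`.
[cite: Hu2025, §4.1 (4.3)] -/
theorem chartEval_rename_inl (q : MvPolynomial (HuVar m) R) :
    chartEval R m o (rename Sum.inl q) =
      algebraMap (MvPolynomial (Fin 3 × Fin m) R) _ (plEval R m q) := by
  induction q using MvPolynomial.induction_on with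
  | C c => rw [rename_C, chartEval_C, plEval_C]
  | add p q hp hq => rw [map_add, map_add, map_add, map_add, hp, hq]
  | mul_X p v hp => rw [map_mul, rename_X, map_mul, map_mul, map_mul, hp, plEval_X, chartEval_X_inl]

/-- `t/aᵢ = t · (1/aᵢ)`: the generator is `R₀`-linear in its numerator. [folklore] -/
theorem prodChartGen_eq_algebraMap_mul_one {ι : Type*} [DecidableEq ι] (s : Finset ι)
    (a : ι → MvPolynomial (Fin 3 × Fin m) R) (i : ι) (t : MvPolynomial (Fin 3 × Fin m) R) :
    prodChartGen s a i t = algebraMap _ _ t * prodChartGen s a i 1 := by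
  rw [← prodChartGen_mul_left, mul_one]

variable (ho : ∀ F, (o F).relOf = F)
include ho

/-- **De-homogenisation: `x_{o_F} ↦ 1`** ("`x_{𝔙,(u_{o_F},v_{o_F})} ≡ 1`"). [cite: Hu2025, §5 Def. 5.1] -/
theorem chartEval_X_choice (F : LeadVar m) : chartEval R m o (X (Sum.inr (o F))) = 1 := by
  rw [chartEval_X_inr, ho]
  exact prodChartGen_self Finset.univ (fun F => rCoordVal R m (o F)) (Finset.mem_univ F)

omit ho in
/-- **The governing binomials vanish on `𝒱 ∩ 𝔙`**: `chartEval (B_{F,s}) = 0`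
(`(t_s/t_o) · minor_{u_F} = (t_{s_F}/t_o) · minor_{u_s} minor_{v_s}`). [cite: Hu2025, Cor. 4.46 and Lemma 4.4] -/
@[simp] theorem chartEval_govBinomial (s : HuTerm m) : chartEval R m o (govBinomial R m s) = 0 := by
  simp only [govBinomial, map_sub, map_mul, chartEval_X_inl, chartEval_X_inr, HuRVar.relOf_inr,
    HuRVar.relOf_inl, rCoordVal_inr, rCoordVal_inl]
  rw [prodChartGen_eq_algebraMap_mul_one R m _ _ _
      (HuGamma.minor R m (HuVar.toTriple s.fst) * HuGamma.minor R m (HuVar.toTriple s.snd)),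
    prodChartGen_eq_algebraMap_mul_one R m _ _ _ (HuGamma.minor R m (HuVar.toTriple (Sum.inr s.rel))),
    map_mul]
  ring

omit ho in
/-- **The non-governing binomials vanish on `𝒱 ∩ 𝔙`**: `chartEval (B_{F,(s,t)}) = 0` for
`s, t ∈ S_F ∖ s_F` (the SAME `F`: the two `𝔯`-variables are coordinates of the same `ℙ_F`).
[cite: Hu2025, Cor. 4.46 and Lemma 4.4] -/
theorem chartEval_ngvBinomial {s t : HuTerm m} (hst : s.rel = t.rel) :
    chartEval R m o (ngvBinomial R m s t) = 0 := by
  simp only [ngvBinomial, map_sub, map_mul, chartEval_X_inl, chartEval_X_inr, HuRVar.relOf_inr,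
    rCoordVal_inr, hst]
  rw [prodChartGen_eq_algebraMap_mul_one R m _ _ _
      (HuGamma.minor R m (HuVar.toTriple s.fst) * HuGamma.minor R m (HuVar.toTriple s.snd)),
    prodChartGen_eq_algebraMap_mul_one R m _ _ _
      (HuGamma.minor R m (HuVar.toTriple t.fst) * HuGamma.minor R m (HuVar.toTriple t.snd)),
    map_mul, map_mul]
  -- both `𝔯`-variables de-homogenise with the same factor `1/t_{o_F}`, `F = rel s = rel t`
  ring

/-- **The linearized Plücker relations vanish on `𝒱 ∩ 𝔙`**: `chartEval (L_F) = 0`, because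
`chartEval (L_F) = (t_{s_F} + Σ_s sgn(s) t_s) / t_{o_F} = F̄(minors) / t_{o_F} = 0`.
[cite: Hu2025, Cor. 4.46 and (4.27)–(4.28)] -/
@[simp] theorem chartEval_linPl (F : LeadVar m) : chartEval R m o (linPl R m F) = 0 := by
  suffices h : chartEval R m o (linPl R m F) =
      algebraMap (MvPolynomial (Fin 3 × Fin m) R) _ (plEval R m (huPhi R m (linPl R m F))) *
        prodChartGen Finset.univ (fun F => rCoordVal R m (o F)) F 1 by
    rw [h, plEval_huPhi_linPl, map_zero, zero_mul]
  have _ := ho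
  rcases F with ⟨k, p⟩ | t
  · simp only [linPl, map_add, map_mul, Fin.sum_univ_two, chartEval_C, huPhi_C, plEval_C,
      plEval_huPhi_X_rvar, chartEval_X_inr, HuRVar.relOf_inl, HuRVar.relOf_inr, HuTerm.rel_inl,
      rCoordVal_inl, rCoordVal_inr]
    rw [prodChartGen_eq_algebraMap_mul_one R m _ _ _
        (HuGamma.minor R m (HuVar.toTriple (Sum.inr (Sum.inl (k, p))))),
      prodChartGen_eq_algebraMap_mul_one R m _ _ _
        (HuGamma.minor R m (HuVar.toTriple (HuTerm.fst (Sum.inl (k, p, 0)))) *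
          HuGamma.minor R m (HuVar.toTriple (HuTerm.snd (Sum.inl (k, p, 0))))),
      prodChartGen_eq_algebraMap_mul_one R m _ _ _
        (HuGamma.minor R m (HuVar.toTriple (HuTerm.fst (Sum.inl (k, p, 1)))) *
          HuGamma.minor R m (HuVar.toTriple (HuTerm.snd (Sum.inl (k, p, 1)))))]
    simp only [map_mul]
    ring
  · simp only [linPl, map_add, map_mul, Fin.sum_univ_three, chartEval_C, huPhi_C, plEval_C,
      plEval_huPhi_X_rvar, chartEval_X_inr, HuRVar.relOf_inl, HuRVar.relOf_inr, HuTerm.rel_inr,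
      rCoordVal_inl, rCoordVal_inr]
    rw [prodChartGen_eq_algebraMap_mul_one R m _ _ _
        (HuGamma.minor R m (HuVar.toTriple (Sum.inr (Sum.inr t)))),
      prodChartGen_eq_algebraMap_mul_one R m _ _ _
        (HuGamma.minor R m (HuVar.toTriple (HuTerm.fst (Sum.inr (t, 0)))) *
          HuGamma.minor R m (HuVar.toTriple (HuTerm.snd (Sum.inr (t, 0))))),
      prodChartGen_eq_algebraMap_mul_one R m _ _ _
        (HuGamma.minor R m (HuVar.toTriple (HuTerm.fst (Sum.inr (t, 1)))) *
          HuGamma.minor R m (HuVar.toTriple (HuTerm.snd (Sum.inr (t, 1))))),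
      prodChartGen_eq_algebraMap_mul_one R m _ _ _
        (HuGamma.minor R m (HuVar.toTriple (HuTerm.fst (Sum.inr (t, 2)))) *
          HuGamma.minor R m (HuVar.toTriple (HuTerm.snd (Sum.inr (t, 2)))))]
    simp only [map_mul]
    ring

/-- `t_{o_F} ∈ J_F` for the chart choice. [folklore] -/
theorem rCoordVal_choice_mem_termIdeal (F : LeadVar m) : rCoordVal R m (o F) ∈ termIdeal R m F := by
  have h := rCoordVal_mem_termIdeal R m (o F)
  rwa [ho] at h

/-- **The coordinate ring of `𝒱 ∩ 𝔙_o` is the affine blowup algebra of `∏_F J_F` at `∏_F t_{o_F}`**: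
the image of `chartEval o` (an `R`-subalgebra of `R[a_ij][1/∏ t_{o_F}]`) is
`R[a_ij][(∏_F J_F)/(∏_F t_{o_F})]`. Hence the charts `𝒱 ∩ 𝔙_o` are the standard charts of the
blow-up of `𝕌_Gr = Spec R[a_ij]` in the product ideal `∏_F J_F` — `𝒱` is that blow-up (integral,
projective and birational over `𝕌_Gr`). [cite: Hu2025, §4.1 and Cor. 4.46] [cite: StacksProject, Tag 080A] -/
theorem range_chartEval :
    (chartEval R m o).range =
      (blowupAlgebra (∏ F, termIdeal R m F) (chartDenom R m o)).restrictScalars R := by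
  apply le_antisymm
  · rintro _ ⟨f, rfl⟩
    rw [Subalgebra.mem_restrictScalars]
    change chartEval R m o f ∈ blowupAlgebra (∏ F, termIdeal R m F) (chartDenom R m o)
    induction f using MvPolynomial.induction_on with
    | C c =>
      rw [chartEval_C]
      exact Subalgebra.algebraMap_mem _ _
    | add p q hp hq =>
      rw [map_add]
      exact add_mem hp hq
    | mul_X p v hp =>
      rw [map_mul]
      refine mul_mem hp ?_
      rcases v with v | l
      · rw [chartEval_X_inl]
        exact Subalgebra.algebraMap_mem _ _
      · rw [chartEval_X_inr]
        exact prodChartGen_mem_blowupAlgebra Finset.univ (fun F => rCoordVal R m (o F))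
          (termIdeal R m) (fun F _ => rCoordVal_choice_mem_termIdeal R m o ho F) (Finset.mem_univ _)
          (rCoordVal_mem_termIdeal R m l)
  · intro z hz
    rw [Subalgebra.mem_restrictScalars] at hz
    have hz' : z ∈ Algebra.adjoin (MvPolynomial (Fin 3 × Fin m) R)
        (⋃ F ∈ (Finset.univ : Finset (LeadVar m)),
          prodChartGen Finset.univ (fun F => rCoordVal R m (o F)) F '' (rCoordVal R m '' {l | l.relOf = F})) := by
      rw [← blowupAlgebra_prod_span_eq_adjoin Finset.univ (fun F => rCoordVal R m (o F))
        (fun F => rCoordVal R m '' {l | l.relOf = F}) (fun F _ => ⟨o F, ho F, rfl⟩)]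
      exact hz
    refine Algebra.adjoin_induction (fun x hx => ?_) (fun r => ?_) (fun _ _ _ _ => add_mem)
      (fun _ _ _ _ => mul_mem) hz'
    · obtain ⟨F, -, _, ⟨l, hl, rfl⟩, rfl⟩ : ∃ F ∈ (Finset.univ : Finset (LeadVar m)),
          ∃ t ∈ rCoordVal R m '' {l | l.relOf = F},
            prodChartGen Finset.univ (fun F => rCoordVal R m (o F)) F t = x := by
        simpa only [Set.mem_iUnion, Set.mem_image, exists_prop] using hx
      refine ⟨X (Sum.inr l), ?_⟩
      change chartEval R m o (X (Sum.inr l)) = _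
      rw [chartEval_X_inr, show l.relOf = F from hl]
    · obtain ⟨q, rfl⟩ := plEval_surjective R m r
      exact ⟨rename Sum.inl q, chartEval_rename_inl R m o q⟩

end Charts

end Literature.AlgebraicGeometry.Resolution

end
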